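import Summits.QuantumFields.BalabanUV.T4Continuum.Support.LineAveragingPairing
import Summits.QuantumFields.BalabanUV.T4Continuum.Support.ScalarMassTower
import Summits.QuantumFields.BalabanUV.T4Continuum.Support.ScalarBlockTrialFunction
import Summits.QuantumFields.BalabanUV.T4Continuum.Support.ScalarBlockPlanting
import Summits.QuantumFields.BalabanUV.T4Continuum.Support.CovariantBlockAveraging
import Literature.MathematicalPhysics.QuantumFieldTheory.Balaban1983to89.B5Composition116

/-!
# T⁴ programme, spine node NE2 (U1a), sub-row Δ1 «NE2⁰-Dirichlet» — TWO-LEVEL TOOLS FOR BAŁABAN's LINE-SUM AVERAGING (1.18)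
# AGAINST KING's BLOCK AVERAGING / PLANTING: lattice bookkeeping, the combinatorial core of the second pairing identity, and
# `‖Q_n·(S₁ − 1)‖ ≤ 2n⁻¹·n^{−d/2}` in operator norm

NE2 formalisation swarm `b2b-balaban-t4-ne2-formalise-*`, LEAF PROVER 07 (gen 8), owner item O14-b′ «W3-BOX-COMPRESSED» (King's
compressed injected law `‖G_{k+1}·JpR_k − JpR_k·G_k‖` for the faithful star-bond operator `Δ_a(Ω₀)`; owner rulings R33/R34, journal
2026-08-20 l.20956 / l.21267), piece **(P-mass)** «W3-MASS-PAIRING» (OFFER l.20983, CLAIM l.21413), file 1 of 4.  The mass summand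
`a·n^d·avgRᴴavgR` of `RegionGaugeFixedVector.regionDeltaA` is Bałaban's line-sum averaging `B5Block118.QvOp` read on the star bonds; its
two-level commutator with King's planting `J_L` (`KingPairingPlantedLaw.JK`) needs TWO torus identities: the tree's
`LineAveragingPairing.sqrt_smul_QvOp_mul_JK` (`√(L^d)·Q_{Ln}·J_L = Q_n·(1 + c_L(S₁ − 1))`) and its companion for the adjoint direction
(`Q_n·Qavg_L = Q_{Ln} + D_E`, file 2 `LineAveragingTwoLevelPairing`).  THIS FILE supplies the tools:

 * §0 Euclidean division of a refined contour (`Σ_{t<n}Σ_{σ<L} G(σ + Lt) = Σ_{m<Ln} G m`); (the Cauchy–Schwarz steps `‖Σ_s c‖² ≤ #s·Σ‖c‖²`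
   are taken in-proof from Mathlib's `sq_sum_le_card_mul_sum_sq`);
 * §1 one torus: `val_digits`, `digits_add_tstep` (digits along a contour are `(digit + t) mod n`), block tilings for any codomain; two tori:
   `Qavg_mulVec`, `cpt_add_tstep` (`cpt(x + t e_μ) = cpt x + (Lt)e′_μ`), `off_update`, `bpt_glue` / `sum_bpt_fine` (the points of a unit
   block as (coarse cell, fine offset)), **`sum_sum_update`** (`Σ_r Σ_σ F(r[μ ↦ σ]) = L·Σ_r F r`), `sum_tile'`, and **`two_level_cancellation`**
   — THE COMBINATORIAL CORE of file 2: for contour functions `G_r` not depending on the `μ`-offset `r_μ`,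
   `L·(L·Σ_r Σ_{t<n} G_r(r_μ + Lt)) − L·Σ_r Σ_{t′<Ln} G_r(r_μ + t′) = −Σ_r Σ_{σ<L} (Σ_{i<σ} G_r(Ln + i) − Σ_{i<σ} G_r i)` (strided contours
   from all offsets cover the refined contour once; a window shift of `σ ≤ L − 1` steps remains);
 * §2 **`opNorm_QvOp_mul_shiftT_sub_one_le : ‖Q_n·(S₁ − 1)‖ ≤ 2·n⁻¹·(√(n^d))⁻¹`** — the boundary transfer of the first pairing identity is
   small in OPERATOR NORM (the contour sum of `S₁f − f` telescopes to a unit-lattice difference of plain block sums, `QvOp_shiftT_sub_one_mulVec`).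

HONEST FRAMING (T4-DAG p. 1).  `U = 1`; finite torus; Bałaban's line-sum averaging (1.18) and King's block averaging /
planting (2.10) as the tree types them; exact lattice identities and Cauchy–Schwarz only — no Fourier analysis, no regularity of any
field; statements, pairings and constants OURS ([folklore]; the `[cite:]` tags locate the printed OBJECTS, Bałaban and King print no
such two-level identity); ONE summand (the mass term) of ONE displayed binder (W3, King's compressed injected law) of the cell's NE2 crux
is served; W3 on boxes OPEN; Δ1 NOT closed; NE2 (U1a) NOT proved; spine PROVED 0/9 unchanged; NOT [B9] (3.16)/(3.23)–(3.27) as printed;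
NOT infinite volume, NOT a mass gap, NOT the Clay problem, NOT summit progress.  HONEST DEPENDENCY: continuum YM on T⁴ ⇐ BetaPertH ∧ nine
spine estimates (0/9 proved); BetaPertH ⇐ (D1) ∧ (D4) ∧ CAP+tail; G-an2-4 gates asym, D1 and NE2/3/4.  No `sorry`.
-/

noncomputable section

open scoped BigOperators ComplexConjugate Matrix Matrix.Norms.L2Operator
open Finset

namespace Summit.QuantumFields.BalabanUV.T4Continuum.LineAveragingTwoLevel

open Literature.MathematicalPhysics.QuantumFieldTheory.Balaban1983to89.B5Prop11Plancherel (Tor fine unitVec)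
open Literature.MathematicalPhysics.QuantumFieldTheory.Balaban1983to89.B5Prop11Lower (nsq nsq_nonneg)
open Literature.MathematicalPhysics.QuantumFieldTheory.Balaban1983to89.B5Block118 (bpt tstep tstep_zero tstep_succ lineSum
  QvOp QvOp_mulVec bpt_add_tstep)
open Literature.MathematicalPhysics.QuantumFieldTheory.Balaban1983to89.B5Blocks16 (blockOf bpt_val bpt_bijective)
open Literature.MathematicalPhysics.QuantumFieldTheory.Balaban1983to89.B5Composition116 (tstep_add)
open Literature.MathematicalPhysics.QuantumFieldTheory.Balaban1983to89.B5G183RateTorus (cpt)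
open Literature.MathematicalPhysics.QuantumFieldTheory.Balaban1983to89.B5G183RateTorusW (off Qavg Qavg_mul_apply)
open Summit.QuantumFields.BalabanUV.T4Continuum
open Summit.QuantumFields.BalabanUV.T4Continuum.BalabanAveragedTowerModes (val_cpt_add_off)
open Summit.QuantumFields.BalabanUV.T4Continuum.BalabanLineAverage (shiftT)
open Summit.QuantumFields.BalabanUV.T4Continuum.KingPairingPlantedLaw (JK opNorm_JK_le sqrt_facts)
open Summit.QuantumFields.BalabanUV.T4Continuum.LineAveragingPairing (glue glue_val sum_glue shiftT_mulVec lineSum_shiftT_sub cL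
  cL_eq norm_cL_le sqrt_smul_QvOp_mul_JK sum_range_shift)
open Summit.QuantumFields.BalabanUV.T4Continuum.ScalarMassTower (cpt_add_unitVec)
open Summit.QuantumFields.BalabanUV.T4Continuum.ScalarBlockTrialFunction (digits digits_bpt)
open Summit.QuantumFields.BalabanUV.T4Continuum.BalabanBlockPoincare (tileEquiv nsq_mulVec_le_rect)
open Summit.QuantumFields.BalabanUV.T4Continuum.CovariantBlockAveraging (opNorm_le_of_sq_le' opNorm_QvOp_le)

variable {d : ℕ}

/-! ## §0 Elementary inequalities -/

/-- Euclidean division enumerates a refined contour: `Σ_{t<n} Σ_{σ<L} G(σ + L·t) = Σ_{m<L·n} G(m)`. [folklore] -/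
theorem sum_sum_range_eq_sum_range_mul {β : Type*} [AddCommMonoid β] (G : ℕ → β) (L n : ℕ) :
    ∑ t ∈ range n, ∑ σ ∈ range L, G (σ + L * t) = ∑ m ∈ range (L * n), G m := by
  induction n with
  | zero => simp
  | succ n ih =>
      rw [sum_range_succ, ih, Nat.mul_succ, sum_range_add]
      congr 1
      exact sum_congr rfl fun σ _ => by rw [add_comm]

/-! ## §1 Lattice bookkeeping on one torus and between two levels -/

section OneTorus

variable (n : ℕ) [NeZero n] (M : Fin d → ℕ) [hM : ∀ μ, NeZero (M μ)]

/-- the `ν`-digit is the residue of the coordinate modulo `n`. [folklore] -/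
theorem val_digits (x : Tor (fine n M)) (ν : Fin d) : ((digits n M x ν : ℕ)) = (x ν).val % n := by
  have hx : bpt n M (blockOf n M x) (digits n M x) = x := by
    unfold blockOf digits
    exact (Equiv.ofBijective _ (bpt_bijective n M)).apply_symm_apply x
  have h := bpt_val n M (blockOf n M x) (digits n M x) ν
  rw [hx] at h
  rw [h, Nat.mul_add_mod, Nat.mod_eq_of_lt (digits n M x ν).isLt]

/-- digits along a straight contour: `digit_ν(x + t e_ν) = (digit_ν(x) + t) mod n`. [folklore] -/
theorem digits_add_tstep (x : Tor (fine n M)) (ν : Fin d) (t : ℕ) :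
    ((digits n M (x + tstep (fine n M) ν t) ν : ℕ)) = (((digits n M x ν : ℕ)) + t) % n := by
  rw [val_digits, val_digits]
  have hv : ((x + tstep (fine n M) ν t) ν).val = ((x ν).val + t) % (fine n M ν) := by
    rw [Pi.add_apply, ZMod.val_add]
    simp only [tstep, if_true, ZMod.val_natCast, Nat.add_mod_mod]
  rw [hv, Nat.mod_add_mod]
  exact Nat.mod_mul_right_mod _ _ _

/-- block sums tile the torus (any additive codomain). [folklore] -/
theorem sum_blocks' {β : Type*} [AddCommMonoid β] (F : Tor (fine n M) → β) :
    ∑ x, F x = ∑ y : Tor M, ∑ j : Fin d → Fin n, F (bpt n M y j) := by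
  rw [← (Equiv.ofBijective _ (bpt_bijective n M)).sum_comp F, Fintype.sum_prod_type]
  rfl

/-- translation invariance of full torus sums. [folklore] -/
theorem sum_add_const {β : Type*} [AddCommMonoid β] (F : Tor (fine n M) → β) (c : Tor (fine n M)) :
    ∑ x, F (x + c) = ∑ x, F x :=
  Fintype.sum_equiv (Equiv.addRight c) (fun x => F (x + c)) F fun _ => rfl

end OneTorus

section TwoTori

variable (n L : ℕ) [NeZero n] [NeZero L] (M : Fin d → ℕ) [hM : ∀ μ, NeZero (M μ)]

/-- King's block averaging on vectors: `(Q_L g)(x, μ) = L^{−d} Σ_r g(L·x + r, μ)`. [cite: King1986, (2.10) p.653] [folklore] -/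
theorem Qavg_mulVec (g : Tor (fine (L * n) M) × Fin d → ℂ) (i : Tor (fine n M) × Fin d) :
    (Qavg n L M *ᵥ g) i = ((L : ℂ) ^ d)⁻¹ * ∑ r : Fin d → Fin L, g (cpt n L M i.1 + off n L M r, i.2) := by
  have e : (Qavg n L M *ᵥ g) i = (Qavg n L M * Matrix.of fun x (_ : Unit) => g x) i () := rfl
  rw [e, Qavg_mul_apply]
  rfl

omit [NeZero L] in
/-- the corner map commutes with straight-contour steps: `cpt(x + t e_μ) = cpt x + (L·t) e′_μ`. [folklore] -/
theorem cpt_add_tstep (x : Tor (fine n M)) (μ : Fin d) (t : ℕ) :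
    cpt n L M (x + tstep (fine n M) μ t) = cpt n L M x + tstep (fine (L * n) M) μ (L * t) := by
  induction t with
  | zero => rw [tstep_zero, add_zero, Nat.mul_zero, tstep_zero, add_zero]
  | succ t ih =>
      rw [tstep_succ, ← add_assoc, cpt_add_unitVec, ih, add_assoc, ← tstep_add, Nat.mul_succ]

omit [NeZero n] hM in
/-- the offset splits off its `μ`-coordinate: `off r = off (r[μ ↦ 0]) + r_μ e′_μ`. [folklore] -/
theorem off_update (r : Fin d → Fin L) (μ : Fin d) (σ : Fin L) :
    off n L M (Function.update r μ σ) = off n L M (Function.update r μ 0) + tstep (fine (L * n) M) μ σ := by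
  funext ν
  simp only [off, tstep, Pi.add_apply]
  by_cases h : ν = μ
  · subst h; simp
  · simp [h]

/-- the glued block point: `(L·n)·y + (L·j + r) = L·(n·y + j) + r`. [folklore] -/
theorem bpt_glue (y : Tor M) (j : Fin d → Fin n) (r : Fin d → Fin L) :
    bpt (L * n) M y (glue n L (j, r)) = cpt n L M (bpt n M y j) + off n L M r := by
  funext ν
  apply ZMod.val_injective
  rw [bpt_val, val_cpt_add_off, bpt_val, glue_val]
  ring

/-- sums over the fine points of a unit block, two ways. [folklore] -/
theorem sum_bpt_fine {β : Type*} [AddCommMonoid β] (G : Tor (fine (L * n) M) → β) (y : Tor M) :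
    ∑ j' : Fin d → Fin (L * n), G (bpt (L * n) M y j')
      = ∑ j : Fin d → Fin n, ∑ r : Fin d → Fin L, G (cpt n L M (bpt n M y j) + off n L M r) := by
  rw [sum_glue]
  simp_rw [bpt_glue]

omit [NeZero n] [NeZero L] in
/-- the fibre count of the coordinate update: `Σ_r Σ_σ F(r[μ ↦ σ]) = L · Σ_r F(r)`. [folklore] -/
theorem sum_sum_update {β : Type*} [AddCommMonoid β] (μ : Fin d) (F : (Fin d → Fin L) → β) :
    ∑ r : Fin d → Fin L, ∑ σ : Fin L, F (Function.update r μ σ) = L • ∑ r : Fin d → Fin L, F r := by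
  classical
  set e := Equiv.funSplitAt μ (Fin L) with he
  have h1 : ∀ G : (Fin d → Fin L) → β, ∑ r, G r = ∑ a : Fin L, ∑ q : {j : Fin d // j ≠ μ} → Fin L, G (e.symm (a, q)) := by
    intro G
    rw [← e.symm.sum_comp G, Fintype.sum_prod_type]
  have hupd : ∀ (a σ : Fin L) (q : {j : Fin d // j ≠ μ} → Fin L), Function.update (e.symm (a, q)) μ σ = e.symm (σ, q) := by
    intro a σ q
    funext j
    by_cases hj : j = μ
    · subst hj
      rw [Function.update_self]
      simp [he, Equiv.funSplitAt, Equiv.piSplitAt]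
    · rw [Function.update_of_ne hj]
      simp [he, Equiv.funSplitAt, Equiv.piSplitAt, hj]
  calc ∑ r : Fin d → Fin L, ∑ σ : Fin L, F (Function.update r μ σ)
      = ∑ a : Fin L, ∑ q : {j : Fin d // j ≠ μ} → Fin L, ∑ σ : Fin L, F (e.symm (σ, q)) := by
        rw [h1]
        simp_rw [hupd]
    _ = L • ∑ q : {j : Fin d // j ≠ μ} → Fin L, ∑ σ : Fin L, F (e.symm (σ, q)) := by
        rw [sum_const, card_univ, Fintype.card_fin]
    _ = L • ∑ σ : Fin L, ∑ q : {j : Fin d // j ≠ μ} → Fin L, F (e.symm (σ, q)) := by rw [sum_comm]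
    _ = L • ∑ r : Fin d → Fin L, F r := by rw [← h1 F]

end TwoTori

/-! ## §2 The boundary transfer `Q_n(S₁ − 1)` is a unit-lattice difference of block means: `‖Q_n(S₁ − 1)‖ ≤ 2n⁻¹·n^{−d/2}` -/

section ShiftDefect

variable (n : ℕ) [NeZero n] (M : Fin d → ℕ) [hM : ∀ μ, NeZero (M μ)]

/-- the straight-contour sum of `S₁f − f` TELESCOPES to the far ends of the contours:
`(Q_n(S₁ − 1)f)(y,μ) = n^{−(d+1)}·Σ_j [f(n(y + e_μ) + j, μ) − f(ny + j, μ)]`. [cite: Balaban1984PropagatorsI, (1.18)/(1.20) p.20 (shape)] [folklore] -/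
theorem QvOp_shiftT_sub_one_mulVec (f : Tor (fine n M) × Fin d → ℂ) (y : Tor M) (μ : Fin d) :
    ((QvOp n M * (shiftT (fine n M) 1 - 1)) *ᵥ f) (y, μ)
      = 1 / (n : ℂ) ^ (d + 1) * ∑ j : Fin d → Fin n, (f (bpt n M (y + unitVec M μ) j, μ) - f (bpt n M y j, μ)) := by
  rw [← Matrix.mulVec_mulVec, QvOp_mulVec]
  congr 1
  refine sum_congr rfl fun j _ => ?_
  rw [Matrix.sub_mulVec, Matrix.one_mulVec, lineSum_shiftT_sub, tstep_zero, add_zero, bpt_add_tstep]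

/-- **`‖Q_n·(S₁ − 1)‖ ≤ 2·n⁻¹·n^{−d/2}`** — the boundary-transfer operator of the planted pairing identity
`√(L^d)·Q_{Ln}J_L = Q_n(1 + c_L(S₁ − 1))` is small in OPERATOR NORM (no regularity of the field is used). [folklore] -/
theorem opNorm_QvOp_mul_shiftT_sub_one_le :
    ‖QvOp n M * (shiftT (fine n M) 1 - 1)‖ ≤ 2 * ((n : ℝ))⁻¹ * (Real.sqrt ((n : ℝ) ^ d))⁻¹ := by
  have hn : (0 : ℝ) < n := by exact_mod_cast Nat.pos_of_ne_zero (NeZero.ne n)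
  have hnd : (0 : ℝ) < (n : ℝ) ^ d := pow_pos hn d
  set X := QvOp n M * (shiftT (fine n M) 1 - 1) with hX
  refine opNorm_le_of_sq_le' X (by positivity) fun f => ?_
  have e0 : ∑ b, ‖∑ i, X b i * f i‖ ^ 2 = ∑ b, ‖(X *ᵥ f) b‖ ^ 2 := rfl
  rw [e0, Fintype.sum_prod_type]
  simp only [hX, QvOp_shiftT_sub_one_mulVec]
  have hc : ‖(1 / (n : ℂ) ^ (d + 1))‖ = ((n : ℝ) ^ (d + 1))⁻¹ := by
    rw [norm_div, norm_one, norm_pow, Complex.norm_natCast, one_div]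
  -- the per-bond bound
  have hterm : ∀ (y : Tor M) (μ : Fin d),
      ‖1 / (n : ℂ) ^ (d + 1) * ∑ j : Fin d → Fin n, (f (bpt n M (y + unitVec M μ) j, μ) - f (bpt n M y j, μ))‖ ^ 2
        ≤ (((n : ℝ) ^ (d + 1))⁻¹) ^ 2 * ((n : ℝ) ^ d * (2 *
            (∑ j : Fin d → Fin n, ‖f (bpt n M (y + unitVec M μ) j, μ)‖ ^ 2
              + ∑ j : Fin d → Fin n, ‖f (bpt n M y j, μ)‖ ^ 2))) := by
    intro y μ
    rw [norm_mul, mul_pow, hc]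
    refine mul_le_mul_of_nonneg_left ?_ (sq_nonneg _)
    have h1 : ‖∑ j : Fin d → Fin n, (f (bpt n M (y + unitVec M μ) j, μ) - f (bpt n M y j, μ))‖ ^ 2
        ≤ (univ : Finset (Fin d → Fin n)).card * ∑ j : Fin d → Fin n, ‖f (bpt n M (y + unitVec M μ) j, μ) - f (bpt n M y j, μ)‖ ^ 2 :=
      (pow_le_pow_left₀ (norm_nonneg _) (norm_sum_le _ _) 2).trans sq_sum_le_card_mul_sum_sq
    simp only [card_univ, Fintype.card_fun, Fintype.card_fin] at h1
    push_cast at h1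
    refine h1.trans ?_
    have h0 : (0 : ℝ) ≤ (n : ℝ) ^ d := by positivity
    refine mul_le_mul_of_nonneg_left ?_ h0
    rw [mul_add, mul_sum, mul_sum, ← sum_add_distrib]
    refine sum_le_sum fun j _ => ?_
    have hs : ‖f (bpt n M (y + unitVec M μ) j, μ) - f (bpt n M y j, μ)‖ ≤ ‖f (bpt n M (y + unitVec M μ) j, μ)‖ + ‖f (bpt n M y j, μ)‖ :=
      norm_sub_le _ _
    nlinarith [norm_nonneg (f (bpt n M (y + unitVec M μ) j, μ) - f (bpt n M y j, μ)), norm_nonneg (f (bpt n M (y + unitVec M μ) j, μ)),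
      norm_nonneg (f (bpt n M y j, μ)), sq_nonneg (‖f (bpt n M (y + unitVec M μ) j, μ)‖ - ‖f (bpt n M y j, μ)‖)]
  refine (sum_le_sum fun y _ => sum_le_sum fun μ _ => hterm y μ).trans ?_
  -- the two block sums are both `Σ_i ‖f i‖²`
  have hSA : ∑ y : Tor M, ∑ μ : Fin d, ∑ j : Fin d → Fin n, ‖f (bpt n M (y + unitVec M μ) j, μ)‖ ^ 2 = ∑ i, ‖f i‖ ^ 2 := by
    calc ∑ y : Tor M, ∑ μ : Fin d, ∑ j : Fin d → Fin n, ‖f (bpt n M (y + unitVec M μ) j, μ)‖ ^ 2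
        = ∑ μ : Fin d, ∑ y : Tor M, ∑ j : Fin d → Fin n, ‖f (bpt n M (y + unitVec M μ) j, μ)‖ ^ 2 := sum_comm
      _ = ∑ μ : Fin d, ∑ y : Tor M, ∑ j : Fin d → Fin n, ‖f (bpt n M y j, μ)‖ ^ 2 :=
          sum_congr rfl fun μ _ => Fintype.sum_equiv (Equiv.addRight (unitVec M μ)) _ _ fun y => rfl
      _ = ∑ μ : Fin d, ∑ x : Tor (fine n M), ‖f (x, μ)‖ ^ 2 :=
          sum_congr rfl fun μ _ => (sum_blocks' n M (fun x => ‖f (x, μ)‖ ^ 2)).symm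
      _ = ∑ x : Tor (fine n M), ∑ μ : Fin d, ‖f (x, μ)‖ ^ 2 := sum_comm
      _ = ∑ i, ‖f i‖ ^ 2 := by rw [Fintype.sum_prod_type]
  have hSB : ∑ y : Tor M, ∑ μ : Fin d, ∑ j : Fin d → Fin n, ‖f (bpt n M y j, μ)‖ ^ 2 = ∑ i, ‖f i‖ ^ 2 := by
    calc ∑ y : Tor M, ∑ μ : Fin d, ∑ j : Fin d → Fin n, ‖f (bpt n M y j, μ)‖ ^ 2
        = ∑ μ : Fin d, ∑ y : Tor M, ∑ j : Fin d → Fin n, ‖f (bpt n M y j, μ)‖ ^ 2 := sum_comm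
      _ = ∑ μ : Fin d, ∑ x : Tor (fine n M), ‖f (x, μ)‖ ^ 2 :=
          sum_congr rfl fun μ _ => (sum_blocks' n M (fun x => ‖f (x, μ)‖ ^ 2)).symm
      _ = ∑ x : Tor (fine n M), ∑ μ : Fin d, ‖f (x, μ)‖ ^ 2 := sum_comm
      _ = ∑ i, ‖f i‖ ^ 2 := by rw [Fintype.sum_prod_type]
  have htot : ∑ y : Tor M, ∑ μ : Fin d, (((n : ℝ) ^ (d + 1))⁻¹) ^ 2 * ((n : ℝ) ^ d * (2 *
            (∑ j : Fin d → Fin n, ‖f (bpt n M (y + unitVec M μ) j, μ)‖ ^ 2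
              + ∑ j : Fin d → Fin n, ‖f (bpt n M y j, μ)‖ ^ 2)))
      = (((n : ℝ) ^ (d + 1))⁻¹) ^ 2 * ((n : ℝ) ^ d * (2 * (∑ i, ‖f i‖ ^ 2 + ∑ i, ‖f i‖ ^ 2))) := by
    simp_rw [← mul_sum]
    simp_rw [sum_add_distrib]
    rw [hSA, hSB]
  rw [htot, mul_pow, mul_pow, inv_pow (Real.sqrt _), Real.sq_sqrt hnd.le]
  have hn0 : (n : ℝ) ≠ 0 := hn.ne'
  apply le_of_eq
  field_simp
  ring

end ShiftDefect

/-! ## §3 Tilings by `L`-blocks and the combinatorial core of the second pairing identity -/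

section TwoLevelCore

variable (n L : ℕ) [NeZero n] [NeZero L] (M : Fin d → ℕ) [hM : ∀ μ, NeZero (M μ)]

/-- sums over the fine torus tiled by the `L`-blocks of the coarse one (any additive codomain). [folklore] -/
theorem sum_tile' {β : Type*} [AddCommMonoid β] (G : Tor (fine (L * n) M) → β) :
    ∑ x', G x' = ∑ x : Tor (fine n M), ∑ r : Fin d → Fin L, G (cpt n L M x + off n L M r) := by
  rw [← Fintype.sum_equiv (tileEquiv n L M) (fun p => G (tileEquiv n L M p)) G (fun _ => rfl), Fintype.sum_prod_type]
  rfl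

omit [NeZero n] [NeZero L] in
/-- THE COMBINATORIAL CORE (one coarse cell, one direction `μ`): for a family of contour functions `G_r : ℕ → ℂ` that does not
depend on the `μ`-offset `r_μ`, the `L`-STRIDED contours started at all `L^d` offsets, weighted `L²`, and the FULL refined contours
started at all offsets, weighted `L`, differ by a window shift of at most `L − 1` steps:
`L·(L·Σ_r Σ_{t<n} G_r(r_μ + Lt)) − L·Σ_r Σ_{t′<Ln} G_r(r_μ + t′) = −Σ_r Σ_{σ<L} (Σ_{i<σ} G_r(Ln + i) − Σ_{i<σ} G_r(i))`. [folklore] -/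
theorem two_level_cancellation (μ : Fin d) {G : (Fin d → Fin L) → ℕ → ℂ}
    (hG : ∀ (r : Fin d → Fin L) (σ : Fin L), G (Function.update r μ σ) = G r) :
    (L : ℂ) * ((L : ℂ) * ∑ r : Fin d → Fin L, ∑ t : Fin n, G r ((r μ : ℕ) + L * t))
        - (L : ℂ) * ∑ r : Fin d → Fin L, ∑ t' : Fin (L * n), G r ((r μ : ℕ) + t')
      = -∑ r : Fin d → Fin L, ∑ σ : Fin L, (∑ i ∈ range σ, G r (L * n + i) - ∑ i ∈ range σ, G r i) := by
  -- the strided contours from all offsets cover the full refined contour once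
  have hA : (L : ℂ) * ∑ r : Fin d → Fin L, ∑ t : Fin n, G r ((r μ : ℕ) + L * t)
      = ∑ r : Fin d → Fin L, ∑ m ∈ range (L * n), G r m := by
    rw [← nsmul_eq_mul, ← sum_sum_update L μ]
    refine sum_congr rfl fun r _ => ?_
    simp_rw [hG, Function.update_self]
    have hin : ∀ σ : ℕ, ∑ t : Fin n, G r (σ + L * t) = ∑ t ∈ range n, G r (σ + L * t) := fun σ =>
      Fin.sum_univ_eq_sum_range (fun t => G r (σ + L * t)) n
    rw [Fin.sum_univ_eq_sum_range (fun σ => ∑ t : Fin n, G r (σ + L * t)) L]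
    simp_rw [hin]
    rw [sum_comm]
    exact sum_sum_range_eq_sum_range_mul (G r) L n
  have hAA : (L : ℂ) * ((L : ℂ) * ∑ r : Fin d → Fin L, ∑ t : Fin n, G r ((r μ : ℕ) + L * t))
      = ∑ r : Fin d → Fin L, ∑ _σ : Fin L, ∑ m ∈ range (L * n), G r m := by
    rw [hA, ← nsmul_eq_mul, ← sum_sum_update L μ]
    simp_rw [hG]
  have hB : (L : ℂ) * ∑ r : Fin d → Fin L, ∑ t' : Fin (L * n), G r ((r μ : ℕ) + t')
      = ∑ r : Fin d → Fin L, ∑ σ : Fin L, ∑ t' ∈ range (L * n), G r (σ + t') := by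
    rw [← nsmul_eq_mul, ← sum_sum_update L μ]
    refine sum_congr rfl fun r _ => sum_congr rfl fun σ _ => ?_
    simp_rw [hG, Function.update_self]
    exact Fin.sum_univ_eq_sum_range (fun t' => G r (σ + t')) (L * n)
  rw [hAA, hB, ← sum_sub_distrib, ← sum_neg_distrib]
  refine sum_congr rfl fun r _ => ?_
  rw [← sum_sub_distrib, ← sum_neg_distrib]
  refine sum_congr rfl fun σ _ => ?_
  rw [sum_range_shift (G r) (L * n) σ]
  ring

end TwoLevelCore

end Summit.QuantumFields.BalabanUV.T4Continuum.LineAveragingTwoLevel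

end
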